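import Mathlib

/-!
# `DivisionGap.PerMultiplesHard` (stmt-ValiantsHypothesis-5068), line `uncharged-face-walk`:
two-band tables (stub `stub_twoBandTable`)

Let `ζ = finRotate n` be the row shift `i ↦ i + 1` of the `n × n` board and `π` any permutation of
`Fin n`.  If the margins `(R, C)` are balanced (`Σ R = Σ C`), pairwise close (`R i ≤ C j + n` and
`C j ≤ R i + n`) and of offset `> n²` (`n² + 1 ≤ R i`), then there is a table
`M : Fin n × Fin n →₀ ℕ` with row margins `R` and column margins `C` all of whose cells `(a, b)`
satisfy `π b = a ∨ π b = ζ a`: row `a` uses only the "pattern" column `π⁻¹ a` and the "forward"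
column `π⁻¹ (ζ a)`.

Construction.  With `f := π⁻¹` put `M (a, f a) := R a - y a`, `M (a, f (ζ a)) := y a` and `0`
elsewhere (`table_of_potential`).  The rows are right as soon as `y ≤ R`; the column `f (ζ a)`
receives `R (ζ a) - y (ζ a)` from the pattern cell of row `ζ a` and `y a` from the forward cell of
row `a`, so the columns are right iff `y (ζ a) - y a = R (ζ a) - C (f (ζ a))` for every `a`.
Along the cycle `0, 1, …, n - 1` of `ζ` these equations are solved by the partial sums of the
defects `D a := R a - C (f a)` (the wrap-around closes up because `Σ D = Σ R - Σ C = 0`), shifted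
by their minimum to become nonnegative (`exists_potential`).  Closeness gives `|D| ≤ n`, so the
shifted partial sums are at most `(n - 1) · n < n² + 1 ≤ R`, which makes the subtraction
`R a - y a` genuine.
-/

open scoped BigOperators

set_option linter.dupNamespace false

namespace Summit.ValiantsHypothesis.ValiantsHypothesis.Theorems.DivisionGap.PerMultiplesHard.TwoBandTable

/-! ### The table attached to a potential -/

/-- Given `y ≤ R` satisfying the column equations `R (ζ a) - y (ζ a) + y a = C (π⁻¹ (ζ a))`
(`ζ = finRotate n`), the table with `M (a, π⁻¹ a) = R a - y a`, `M (a, π⁻¹ (ζ a)) = y a` and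
zero elsewhere has row margins `R`, column margins `C`, and lives on the cells `(a, b)` with
`π b = a ∨ π b = ζ a`. [folklore] -/
theorem table_of_potential {n : ℕ} (π : Equiv.Perm (Fin n)) (R C y : Fin n → ℕ)
    (hy : ∀ a, y a ≤ R a)
    (hcol : ∀ a, R (finRotate n a) - y (finRotate n a) + y a = C (π.symm (finRotate n a))) :
    ∃ M : (Fin n × Fin n) →₀ ℕ,
      (∀ e ∈ M.support, π e.2 = e.1 ∨ π e.2 = finRotate n e.1) ∧
      (∀ i, ∑ j, M (i, j) = R i) ∧ (∀ j, ∑ i, M (i, j) = C j) := by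
  refine ⟨Finsupp.equivFunOnFinite.symm fun e =>
      (if e.2 = π.symm e.1 then R e.1 - y e.1 else 0) +
        (if e.2 = π.symm (finRotate n e.1) then y e.1 else 0), ?_, ?_, ?_⟩
  · -- the support lies on the pattern cells `(a, π⁻¹ a)` and the forward cells `(a, π⁻¹ (ζ a))`
    intro e he
    simp only [Finsupp.mem_support_iff, Finsupp.coe_equivFunOnFinite_symm] at he
    by_contra h
    obtain ⟨h1, h2⟩ := not_or.mp h
    refine he ?_
    rw [if_neg fun h' => h1 (by rw [h', Equiv.apply_symm_apply]),
      if_neg fun h' => h2 (by rw [h', Equiv.apply_symm_apply])]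
    rfl
  · -- row `i` carries `(R i - y i) + y i`
    intro i
    simp only [Finsupp.coe_equivFunOnFinite_symm, Finset.sum_add_distrib, Finset.sum_ite_eq',
      Finset.mem_univ, if_true]
    exact Nat.sub_add_cancel (hy i)
  · -- column `j` receives `R (π j) - y (π j)` from row `π j` and `y (ζ⁻¹ (π j))` from row
    -- `ζ⁻¹ (π j)`
    intro j
    simp only [Finsupp.coe_equivFunOnFinite_symm, Finset.sum_add_distrib]
    have e2 : ∀ i : Fin n, j = π.symm (finRotate n i) ↔ (finRotate n).symm (π j) = i :=
      fun i => by rw [Equiv.eq_symm_apply, Equiv.symm_apply_eq]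
    have e1 : ∀ i : Fin n, j = π.symm i ↔ π j = i := fun i => Equiv.eq_symm_apply π
    simp_rw [e2, e1, Finset.sum_ite_eq, Finset.mem_univ, if_true]
    have h := hcol ((finRotate n).symm (π j))
    rwa [Equiv.apply_symm_apply, Equiv.symm_apply_apply] at h

/-! ### Potentials along the cycle of `finRotate` -/

/-- If `D : Fin (m + 1) → ℤ` sums to zero and `|D| ≤ B`, there is a potential `Y` with
`Y (ζ a) - Y a = D (ζ a)` for every `a` (`ζ = finRotate (m + 1)`) and `0 ≤ Y ≤ m · B`: the partial
sums of `D` along the cycle `0, 1, …, m` of `ζ`, shifted by their minimum. [folklore] -/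
theorem exists_potential (m : ℕ) (D : Fin (m + 1) → ℤ) (hD : ∑ a, D a = 0) (B : ℕ)
    (hB : ∀ a, -(B : ℤ) ≤ D a ∧ D a ≤ B) :
    ∃ Y : Fin (m + 1) → ℤ,
      (∀ a, Y (finRotate (m + 1) a) - Y a = D (finRotate (m + 1) a)) ∧
      (∀ a, 0 ≤ Y a) ∧ (∀ a, Y a ≤ m * B) := by
  -- extend `D` by zero to `ℕ` and take partial sums `S k = D 0 + ⋯ + D k`
  set D' : ℕ → ℤ := fun l => if h : l < m + 1 then D ⟨l, h⟩ else 0 with hD'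
  set S : ℕ → ℤ := fun k => ∑ l ∈ Finset.range (k + 1), D' l with hS
  have hD'B : ∀ l, -(B : ℤ) ≤ D' l ∧ D' l ≤ B := by
    intro l
    simp only [hD']
    split_ifs with h
    · exact hB _
    · exact ⟨by omega, by omega⟩
  have hstep : ∀ k, S (k + 1) = S k + D' (k + 1) := fun k => Finset.sum_range_succ _ _
  -- increments over `d` steps are bounded by `d * B` in both directions
  have hbound : ∀ k d : ℕ, S (k + d) - S k ≤ d * B ∧ S k - S (k + d) ≤ d * B := by
    intro k d
    induction d with
    | zero => simp
    | succ d ih =>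
      rw [← add_assoc, hstep]
      obtain ⟨h1, h2⟩ := hD'B (k + d + 1)
      obtain ⟨ih1, ih2⟩ := ih
      have e : ((d + 1 : ℕ) : ℤ) * B = d * B + B := by push_cast; ring
      rw [e]
      exact ⟨by linarith, by linarith⟩
  -- shift by the minimum of the partial sums
  obtain ⟨k₀, hk₀, hmin⟩ := Finset.exists_min_image (Finset.range (m + 1)) S ⟨0, by simp⟩
  rw [Finset.mem_range] at hk₀
  refine ⟨fun a => S a - S k₀, fun a => ?_, fun a => ?_, fun a => ?_⟩
  · -- the step equations, including the wrap-around at the last element of the cycle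
    rw [sub_sub_sub_cancel_right]
    rcases Fin.eq_castSucc_or_eq_last a with ⟨j, rfl⟩ | rfl
    · have hj : finRotate (m + 1) (Fin.castSucc j) = j.succ := finRotate_of_lt j.isLt
      rw [hj, Fin.val_succ, Fin.val_castSucc, hstep, add_sub_cancel_left]
      simp only [hD', dif_pos (show (j : ℕ) + 1 < m + 1 by omega)]
      rfl
    · rw [finRotate_last, Fin.val_zero, Fin.val_last]
      have h0 : S 0 = D 0 := by
        simp only [hS, zero_add, Finset.sum_range_one, hD', dif_pos (show 0 < m + 1 by omega)]
        rfl
      have hm : S m = 0 := by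
        simp only [hS]
        rw [Finset.sum_range, ← hD]
        exact Finset.sum_congr rfl fun i _ => by simp only [hD', dif_pos i.isLt, Fin.eta]
      rw [h0, hm, sub_zero]
  · -- nonnegativity
    have := hmin a (Finset.mem_range.mpr a.isLt)
    linarith
  · -- upper bound: `a` and `k₀` are at most `m` steps apart
    have hB0 : (0 : ℤ) ≤ B := by positivity
    rcases Nat.lt_or_ge a k₀ with h | h
    · obtain ⟨d, hd⟩ := Nat.exists_eq_add_of_lt h
      have hdm : ((d + 1 : ℕ) : ℤ) ≤ m := by exact_mod_cast (show d + 1 ≤ m by omega)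
      have := (hbound a (d + 1)).2
      rw [show (a : ℕ) + (d + 1) = k₀ by omega] at this
      exact this.trans (mul_le_mul_of_nonneg_right hdm hB0)
    · obtain ⟨d, hd⟩ := Nat.exists_eq_add_of_le h
      have hdm : (d : ℤ) ≤ m := by exact_mod_cast (show d ≤ m by omega)
      have := (hbound k₀ d).1
      rw [← hd] at this
      exact this.trans (mul_le_mul_of_nonneg_right hdm hB0)

/-! ### The two-band table -/

/-- **Two-band (spread) probes exist in every complete class of balanced, close margins of offset
`> n²`.**  Let `ζ = finRotate n`.  If `Σ R = Σ C`, `R i ≤ C j + n` and `C j ≤ R i + n` for all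
`i, j`, and `n² + 1 ≤ R i` for all `i`, then for every permutation `π` of `Fin n` there is a table
`M` with row margins `R` and column margins `C` every cell `(a, b)` of which satisfies
`π b = a ∨ π b = ζ a`. [folklore] -/
theorem stub_twoBandTable :
    ∀ (n : ℕ) (π : Equiv.Perm (Fin n)) (R C : Fin n → ℕ),
      ∑ i, R i = ∑ j, C j →
      (∀ i j, R i ≤ C j + n ∧ C j ≤ R i + n) →
      (∀ i, n ^ 2 + 1 ≤ R i) →
      ∃ M : (Fin n × Fin n) →₀ ℕ,
        (∀ e ∈ M.support, π e.2 = e.1 ∨ π e.2 = finRotate n e.1) ∧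
        (∀ i, ∑ j, M (i, j) = R i) ∧ (∀ j, ∑ i, M (i, j) = C j) := by
  intro n π R C hbal hclose hoff
  cases n with
  | zero => exact ⟨0, by simp, fun i => i.elim0, fun j => j.elim0⟩
  | succ m =>
    -- the defects `D a = R a - C (π⁻¹ a)` sum to zero and lie in `[-(m + 1), m + 1]`
    set D : Fin (m + 1) → ℤ := fun a => (R a : ℤ) - C (π.symm a) with hD
    have hD0 : ∑ a, D a = 0 := by
      have hC : ∑ a, (C (π.symm a) : ℤ) = ∑ j, (C j : ℤ) := Equiv.sum_comp π.symm fun j => (C j : ℤ)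
      simp only [hD]
      rw [Finset.sum_sub_distrib, hC, sub_eq_zero]
      exact_mod_cast hbal
    have hDB : ∀ a, -((m + 1 : ℕ) : ℤ) ≤ D a ∧ D a ≤ ((m + 1 : ℕ) : ℤ) := by
      intro a
      obtain ⟨h1, h2⟩ := hclose a (π.symm a)
      simp only [hD]
      constructor <;> omega
    obtain ⟨Y, hYstep, hY0, hYle⟩ := exists_potential m D hD0 (m + 1) hDB
    -- `y := Y.toNat ≤ m (m + 1) < (m + 1)² + 1 ≤ R`
    have hyR : ∀ a, (Y a).toNat ≤ R a := by
      intro a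
      rw [Int.toNat_le]
      have h1 := hYle a
      have h2 : (((m + 1) ^ 2 + 1 : ℕ) : ℤ) ≤ R a := by exact_mod_cast hoff a
      push_cast at h1 h2
      nlinarith
    refine table_of_potential π R C (fun a => (Y a).toNat) hyR fun a => ?_
    have h1 := hyR (finRotate (m + 1) a)
    have h := hYstep a
    simp only [hD] at h
    have key : ((R (finRotate (m + 1) a) - (Y (finRotate (m + 1) a)).toNat + (Y a).toNat : ℕ) : ℤ)
        = C (π.symm (finRotate (m + 1) a)) := by
      rw [Nat.cast_add, Nat.cast_sub h1, Int.toNat_of_nonneg (hY0 _), Int.toNat_of_nonneg (hY0 _)]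
      linarith
    exact_mod_cast key

end Summit.ValiantsHypothesis.ValiantsHypothesis.Theorems.DivisionGap.PerMultiplesHard.TwoBandTable
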